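import Literature.Probability.FitznerVanDerHofstad2017.BlockSummation

/-!
# [FvdH17] §5.1 (5.4)–(5.5): composite blocks — sub-multiplicativity and sub-additivity of the block norms, PROVED in abstract form

Source: R. Fitzner, R. van der Hofstad, *Mean-field behavior for nearest-neighbor percolation in `d > 10`*,
Electron. J. Probab. **22** (2017) no. 43 [FvdH17]; page and equation numbers are those of the extended version
arXiv:1506.07977v2 (92 pp.).  §5.1 (p. 48): "We combine the diagrams to create larger diagrams. … Further, we
define the block that we use to bound the intermediate pieces of the diagrams by
`B^{ι,a,b}(0,v,x,y) = Σ_{u,w} Σ_{c=0}^{2} A^{ι,a,c,*}(0,v,u,w) A^{c,b}(u,w,x,y)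
  + Σ_u A^{ι,a,b}(0,v,x,u) P^{0}(y−u,y−u) + B^{(2),ι}(0,v,x,y)`, (5.4)
`B̄^{ι,a,b}(0,v,x,y) = Σ_{u,w} Σ_{c=0}^{2} A^{ι,a,c}(0,v,w,u) A^{c,b,*}(w,u,x,y) + A^{ι,a,b}(0,v,x,y)
  + B̄^{(2),ι,a,b}(0,v,x,y)`. (5.5)"
§5.1 "Elements of the bounds" (p. 49): "`(B)_{a,b} = sup_{v∈ℤ^d} Σ_{ι,x,y∈ℤ^d} B^{ι,a,b}(0,v,x,y)`, …,
`(A^ι)_{a,b} = sup_{v∈ℤ^d} Σ_{ι,x,y∈ℤ^d} A^{ι,a,b}(0,v,x,y)`, `(A)_{a,b} = sup_{v} Σ_{x,y} A^{a,b}(0,v,x,y)`,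
`(Ā^ι)_{a,b} = sup_{v,y∈ℤ^d} Σ_{ι,x,y∈ℤ^d} Ā^{ι,a,b}(0,v,x,x+y)`, …".
The matrices of the composite blocks are obtained from the matrices of their constituents in the authors'
Mathematica notebook [FvdHnb] `Percolation.nb` (cell "Next, we define the bound for B and B̄, see (5.4)-(5.5) of
(II)"): `Matrix[B,s]=Matrix[AiotaNonRep,s].Matrix[A,s]+Matrix[Aiota,s]*Bound[PS,0,s]+Matrix[B2i,s];
Matrix[Bbar,s]=Matrix[Aiota,s].Matrix[ANonRep,s]+Matrix[Aiota,s]+Matrix[Bbar2i,s];`.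

What this module proves — everything is kernel-checked; NOTHING here is a cited hypothesis.  It is the algebra
that turns (5.4)–(5.5) into entrywise matrix inequalities, typed ABSTRACTLY over any additive commutative group `G`
of sites, `[0, ∞]`-valued kernels, a finite type `ι` of length classes and a finite type `K` of directions, with the
norms `normB` (closed exit pair) and `normOO` (double-open exit pair) and the matrices `matB`, `matAbar` of
`BlockSummation`:
* `comp M₁ M₂` — composition of two four-point blocks over the shared pair, `Σ_{w,t} M₁(u,v,w,t) M₂(w,t,x,y)`
  (the shape of the first terms of (5.4) and (5.5)); `IsTransInv.comp`;
* `normB_comp_le` — `(M₁∘M₂) ≤ (M₁)·(M₂)` when `M₂` is translation invariant; `normOO_comp_le` — a closed block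
  followed by a double-open one is double-open: `(M₁∘M₂)^{open} ≤ (M₁)·(M₂)^{open}`;
* `normB_compVertex_le` — composition with a vertex kernel on the last leg, the shape of the second term of (5.4):
  `sup_v Σ_{x,y} Σ_t M(0,v,x,t) q(y−t) ≤ (M) · Σ_z q(z)`;
* `normB_add_le`, `normOO_add_le`, `normB_finsetSum_le`, `normOO_finsetSum_le` — sub-additivity;
* `matB_comp_le`, `matAbar_comp_le` — the matrix level in the (5.4)/(5.5) shape: for a family `A₁^{κ,a,c}`
  carrying the direction index and a direction-free family `A₂^{c,b}`,
  `matB (κ,a,b ↦ Σ_c A₁^{κ,a,c} ∘ A₂^{c,b}) ≤ matB A₁ * matB₀ A₂` entrywise (the finite `κ`-sum stays inside the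
  supremum of the FIRST factor, as in `(A^ι)_{a,b} = sup_v Σ_{ι,x,y} …`), and the same with a double-open second
  factor; `matB_add_le`, `matAbar_add_le`.
Orientation: throughout, as printed in §5.1, the supremum is over the FIRST (entry) pair and the sums over the exit
pair; nothing is asserted here about blocks traversed in the opposite direction.

NOT in this module: the percolation block kernels `A, A^ι, A^*, B^{(2),ι}, …` of §5.1 themselves (so no numerical
matrix is produced here), the weighted blocks `C^{(1)}, C^{(2)}, H^{(i)}`, and any statement about dimensions.
-/

noncomputable section

namespace Literature.Probability.FitznerVanDerHofstad2017.BlockSummation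

open scoped ENNReal Matrix

/-! ## Composition of blocks over a shared pair -/

section Comp

variable {G : Type*}

/-- Composition of two four-point blocks over the shared middle pair:
`(M₁ ∘ M₂)(u,v,x,y) = Σ_{w,t} M₁(u,v,w,t) M₂(w,t,x,y)` — the shape of `Σ_{u,w} A^{ι,a,c,*}(0,v,u,w) A^{c,b}(u,w,x,y)`
in (5.4) and of `Σ_{u,w} A^{ι,a,c}(0,v,w,u) A^{c,b,*}(w,u,x,y)` in (5.5).
[cite: FitznerVanDerHofstad2017, §5.1 (5.4)–(5.5) (arXiv:1506.07977v2 p. 48)] -/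
def comp (M₁ M₂ : G → G → G → G → ℝ≥0∞) : G → G → G → G → ℝ≥0∞ :=
  fun u v x y => ∑' w, ∑' t, M₁ u v w t * M₂ w t x y

/-- Tonelli: the exit-pair sum of a composite block factors through the middle pair. [folklore] -/
theorem tsum₂_comp (M₁ M₂ : G → G → G → G → ℝ≥0∞) (u v : G) :
    ∑' x, ∑' y, comp M₁ M₂ u v x y = ∑' w, ∑' t, M₁ u v w t * ∑' x, ∑' y, M₂ w t x y := by
  unfold comp
  rw [show (∑' x, ∑' y, ∑' w, ∑' t, M₁ u v w t * M₂ w t x y)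
      = ∑' w, ∑' t, ∑' x, ∑' y, M₁ u v w t * M₂ w t x y from (tsum_rot₄ _).trans (tsum_rot₄ _)]
  simp only [ENNReal.tsum_mul_left]

/-- Tonelli along the diagonal `y ↦ x + y`: `Σ_x (M₁∘M₂)(u,v,x,x+y) = Σ_{w,t} M₁(u,v,w,t) Σ_x M₂(w,t,x,x+y)`.
[folklore] -/
theorem tsum_comp_diag (M₁ M₂ : G → G → G → G → ℝ≥0∞) [Add G] (u v y : G) :
    ∑' x, comp M₁ M₂ u v x (x + y) = ∑' w, ∑' t, M₁ u v w t * ∑' x, M₂ w t x (x + y) := by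
  unfold comp
  rw [tsum_rot₃ (fun x w t => M₁ u v w t * M₂ w t x (x + y))]
  simp only [ENNReal.tsum_mul_left]

variable [AddCommGroup G]

/-- The composite of two translation-invariant blocks is translation invariant. [folklore] -/
theorem IsTransInv.comp {M₁ M₂ : G → G → G → G → ℝ≥0∞} (h₁ : IsTransInv M₁) (h₂ : IsTransInv M₂) :
    IsTransInv (comp M₁ M₂) := by
  intro g u v x y
  show (∑' w, ∑' t, M₁ (u + g) (v + g) w t * M₂ w t (x + g) (y + g)) = ∑' w, ∑' t, M₁ u v w t * M₂ w t x y
  calc (∑' w, ∑' t, M₁ (u + g) (v + g) w t * M₂ w t (x + g) (y + g))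
      = ∑' w, ∑' t, M₁ (u + g) (v + g) (w + g) (t + g) * M₂ (w + g) (t + g) (x + g) (y + g) := by
        rw [← tsum_add_right_eq (fun w => ∑' t, M₁ (u + g) (v + g) w t * M₂ w t (x + g) (y + g)) g]
        exact tsum_congr fun w =>
          (tsum_add_right_eq (fun t => M₁ (u + g) (v + g) (w + g) t * M₂ (w + g) t (x + g) (y + g)) g).symm
    _ = ∑' w, ∑' t, M₁ u v w t * M₂ w t x y := by simp only [h₁ g, h₂ g]

/-- `Σ_{x,y} M(0,v,x,y) ≤ (M)` (no hypothesis). [folklore] -/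
theorem tsum₂_zero_le_normB (M : G → G → G → G → ℝ≥0∞) (v : G) : ∑' x, ∑' y, M 0 v x y ≤ normB M := by
  unfold normB
  exact le_iSup (fun v => ∑' x, ∑' y, M 0 v x y) v

/-- `Σ_x M(0,v,x,x+y) ≤ (M)^{open}` (no hypothesis). [folklore] -/
theorem tsum_zero_le_normOO (M : G → G → G → G → ℝ≥0∞) (v y : G) : ∑' x, M 0 v x (x + y) ≤ normOO M := by
  unfold normOO
  exact le_iSup₂ (f := fun v y => ∑' x, M 0 v x (x + y)) v y

/-- For a translation-invariant block, `Σ_x M(w,t,x,x+y) ≤ (M)^{open}` for every entry pair `(w,t)` and gap `y`.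
[folklore] -/
theorem tsum_le_normOO {M : G → G → G → G → ℝ≥0∞} (hM : IsTransInv M) (w t y : G) :
    ∑' x, M w t x (x + y) ≤ normOO M := by
  have h : ∀ x, M w t x (x + y) = M 0 (t - w) (x - w) (x - w + y) := by
    intro x
    have := hM w 0 (t - w) (x - w) (x - w + y)
    simp only [zero_add, sub_add_cancel] at this
    rw [show x - w + y + w = x + y by abel] at this
    exact this
  calc ∑' x, M w t x (x + y) = ∑' x, M 0 (t - w) (x - w) (x - w + y) := tsum_congr h
    _ = ∑' x, M 0 (t - w) x (x + y) := tsum_sub_right_eq (fun x => M 0 (t - w) x (x + y)) w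
    _ ≤ normOO M := tsum_zero_le_normOO M (t - w) y

/-- **Sub-multiplicativity, closed ∘ closed** (the first term of (5.4)/(5.5) at the level of one pair of classes:
`sup_v Σ_{x,y} Σ_{w,t} M₁(0,v,w,t) M₂(w,t,x,y) ≤ (M₁)(M₂)` for translation-invariant `M₂`).
[cite: FitznerVanDerHofstad2017, §5.1 (5.4)–(5.5) and "Elements of the bounds" (arXiv:1506.07977v2 pp. 48–49)] -/
theorem normB_comp_le (M₁ : G → G → G → G → ℝ≥0∞) {M₂ : G → G → G → G → ℝ≥0∞} (h₂ : IsTransInv M₂) :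
    normB (comp M₁ M₂) ≤ normB M₁ * normB M₂ := by
  unfold normB
  refine iSup_le fun v => ?_
  rw [tsum₂_comp]
  calc ∑' w, ∑' t, M₁ 0 v w t * ∑' x, ∑' y, M₂ w t x y
      ≤ ∑' w, ∑' t, M₁ 0 v w t * ⨆ v, ∑' x, ∑' y, M₂ 0 v x y :=
        ENNReal.tsum_le_tsum fun w => ENNReal.tsum_le_tsum fun t =>
          mul_le_mul' le_rfl (tsum₂_le_normB h₂ w t)
    _ = (∑' w, ∑' t, M₁ 0 v w t) * ⨆ v, ∑' x, ∑' y, M₂ 0 v x y := by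
        simp only [ENNReal.tsum_mul_right]
    _ ≤ (⨆ v, ∑' x, ∑' y, M₁ 0 v x y) * ⨆ v, ∑' x, ∑' y, M₂ 0 v x y :=
        mul_le_mul' (tsum₂_zero_le_normB M₁ v) le_rfl

/-- **Sub-multiplicativity, closed ∘ double-open** (a closed block followed by a double-open block is double-open;
the shape of `Ā^ι`-type composites): `sup_{v,y} Σ_x Σ_{w,t} M₁(0,v,w,t) M₂(w,t,x,x+y) ≤ (M₁)(M₂)^{open}` for
translation-invariant `M₂`.
[cite: FitznerVanDerHofstad2017, §5.1 "Elements of the bounds" (arXiv:1506.07977v2 p. 49)] -/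
theorem normOO_comp_le (M₁ : G → G → G → G → ℝ≥0∞) {M₂ : G → G → G → G → ℝ≥0∞} (h₂ : IsTransInv M₂) :
    normOO (comp M₁ M₂) ≤ normB M₁ * normOO M₂ := by
  unfold normOO normB
  refine iSup₂_le fun v y => ?_
  rw [tsum_comp_diag]
  calc ∑' w, ∑' t, M₁ 0 v w t * ∑' x, M₂ w t x (x + y)
      ≤ ∑' w, ∑' t, M₁ 0 v w t * ⨆ v, ⨆ y, ∑' x, M₂ 0 v x (x + y) :=
        ENNReal.tsum_le_tsum fun w => ENNReal.tsum_le_tsum fun t =>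
          mul_le_mul' le_rfl (tsum_le_normOO h₂ w t y)
    _ = (∑' w, ∑' t, M₁ 0 v w t) * ⨆ v, ⨆ y, ∑' x, M₂ 0 v x (x + y) := by
        simp only [ENNReal.tsum_mul_right]
    _ ≤ (⨆ v, ∑' x, ∑' y, M₁ 0 v x y) * ⨆ v, ⨆ y, ∑' x, M₂ 0 v x (x + y) :=
        mul_le_mul' (tsum₂_zero_le_normB M₁ v) le_rfl

/-- **Composition with a vertex kernel on the last leg** (the shape of the second term of (5.4),
`Σ_u A^{ι,a,b}(0,v,x,u) P^{0}(y−u,y−u)`): `sup_v Σ_{x,y} Σ_t M(0,v,x,t) q(y−t) ≤ (M) · Σ_z q(z)` (no hypothesis on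
`M`; in the notebook this is the term `Matrix[Aiota,s]*Bound[PS,0,s]`).
[cite: FitznerVanDerHofstad2017, §5.1 (5.4) (arXiv:1506.07977v2 p. 48)] -/
theorem normB_compVertex_le (M : G → G → G → G → ℝ≥0∞) (q : G → ℝ≥0∞) :
    normB (fun u v x y => ∑' t, M u v x t * q (y - t)) ≤ normB M * ∑' z, q z := by
  unfold normB
  refine iSup_le fun v => ?_
  have h : ∀ x, (∑' y, ∑' t, M 0 v x t * q (y - t)) = (∑' t, M 0 v x t) * ∑' z, q z := by
    intro x
    rw [ENNReal.tsum_comm]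
    calc ∑' t, ∑' y, M 0 v x t * q (y - t) = ∑' t, M 0 v x t * ∑' y, q (y - t) := by
          simp only [ENNReal.tsum_mul_left]
      _ = ∑' t, M 0 v x t * ∑' z, q z := by
          refine tsum_congr fun t => ?_
          rw [tsum_sub_right_eq q t]
      _ = (∑' t, M 0 v x t) * ∑' z, q z := by rw [ENNReal.tsum_mul_right]
  simp only [h, ENNReal.tsum_mul_right]
  exact mul_le_mul' (tsum₂_zero_le_normB M v) le_rfl

/-- Sub-additivity of the closed norm. [folklore] -/
theorem normB_add_le (M₁ M₂ : G → G → G → G → ℝ≥0∞) :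
    normB (fun u v x y => M₁ u v x y + M₂ u v x y) ≤ normB M₁ + normB M₂ := by
  unfold normB
  refine iSup_le fun v => ?_
  simp only [ENNReal.tsum_add]
  exact add_le_add (tsum₂_zero_le_normB M₁ v) (tsum₂_zero_le_normB M₂ v)

/-- Sub-additivity of the double-open norm. [folklore] -/
theorem normOO_add_le (M₁ M₂ : G → G → G → G → ℝ≥0∞) :
    normOO (fun u v x y => M₁ u v x y + M₂ u v x y) ≤ normOO M₁ + normOO M₂ := by
  unfold normOO
  refine iSup₂_le fun v y => ?_
  simp only [ENNReal.tsum_add]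
  exact add_le_add (tsum_zero_le_normOO M₁ v y) (tsum_zero_le_normOO M₂ v y)

/-- Sub-additivity of the closed norm over a finite sum of blocks. [folklore] -/
theorem normB_finsetSum_le {κ : Type*} (s : Finset κ) (M : κ → G → G → G → G → ℝ≥0∞) :
    normB (fun u v x y => ∑ i ∈ s, M i u v x y) ≤ ∑ i ∈ s, normB (M i) := by
  unfold normB
  refine iSup_le fun v => ?_
  simp only [tsum_finsetSum]
  exact Finset.sum_le_sum fun i _ => tsum₂_zero_le_normB (M i) v

/-- Sub-additivity of the double-open norm over a finite sum of blocks. [folklore] -/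
theorem normOO_finsetSum_le {κ : Type*} (s : Finset κ) (M : κ → G → G → G → G → ℝ≥0∞) :
    normOO (fun u v x y => ∑ i ∈ s, M i u v x y) ≤ ∑ i ∈ s, normOO (M i) := by
  unfold normOO
  refine iSup₂_le fun v y => ?_
  simp only [tsum_finsetSum]
  exact Finset.sum_le_sum fun i _ => tsum_zero_le_normOO (M i) v y

end Comp

/-! ## Matrix level: the (5.4)/(5.5) shape -/

section MatrixLevel

variable {G ι K : Type*}

/-- The matrix of a direction-free closed block family, `(A)_{a,b} = sup_v Σ_{x,y} A^{a,b}(0,v,x,y)` ([FvdH17]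
§5.1: `(A)_{a,b}`, `(A^*)_{a,b}`). [cite: FitznerVanDerHofstad2017, §5.1 "Elements of the bounds"
(arXiv:1506.07977v2 p. 49)] -/
def matB₀ [AddCommGroup G] (A : ι → ι → G → G → G → G → ℝ≥0∞) : Matrix ι ι ℝ≥0∞ :=
  Matrix.of fun a b => normB (A a b)

/-- The matrix of a direction-free double-open block family, `sup_{v,y} Σ_x A^{a,b}(0,v,x,x+y)`.
[cite: FitznerVanDerHofstad2017, §5.1 "Elements of the bounds" (arXiv:1506.07977v2 p. 49)] -/
def matAbar₀ [AddCommGroup G] (A : ι → ι → G → G → G → G → ℝ≥0∞) : Matrix ι ι ℝ≥0∞ :=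
  Matrix.of fun a b => normOO (A a b)

/-- Entries of `matB₀`. [folklore] -/
theorem matB₀_apply [AddCommGroup G] (A : ι → ι → G → G → G → G → ℝ≥0∞) (a b : ι) :
    matB₀ A a b = normB (A a b) := rfl

/-- Entries of `matAbar₀`. [folklore] -/
theorem matAbar₀_apply [AddCommGroup G] (A : ι → ι → G → G → G → G → ℝ≥0∞) (a b : ι) :
    matAbar₀ A a b = normOO (A a b) := rfl

/-- A direction-free family is a family over the one-point direction type. [folklore] -/
theorem matB₀_eq_matB [AddCommGroup G] (A : ι → ι → G → G → G → G → ℝ≥0∞) :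
    matB₀ A = matB (fun (_ : Unit) a b => A a b) := by
  ext a b
  simp only [matB₀_apply, matB_apply, normB, Finset.univ_unique, Finset.sum_singleton]

/-- A direction-free family is a family over the one-point direction type (double-open version). [folklore] -/
theorem matAbar₀_eq_matAbar [AddCommGroup G] (A : ι → ι → G → G → G → G → ℝ≥0∞) :
    matAbar₀ A = matAbar (fun (_ : Unit) a b => A a b) := by
  ext a b
  simp only [matAbar₀_apply, matAbar_apply, normOO, Finset.univ_unique, Finset.sum_singleton]

/-- **(5.4)/(5.5), first term, at matrix level (closed ∘ closed):** for a family `A₁^{κ,a,c}` carrying the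
direction index and a translation-invariant direction-free family `A₂^{c,b}`,
`sup_v Σ_{κ,x,y} Σ_c (A₁^{κ,a,c} ∘ A₂^{c,b})(0,v,x,y) ≤ Σ_c (A₁)_{a,c} (A₂)_{c,b}`, i.e.
`matB (κ,a,b ↦ Σ_c A₁^{κ,a,c}∘A₂^{c,b}) ≤ matB A₁ * matB₀ A₂` entrywise — the step
`Matrix[AiotaNonRep,s].Matrix[A,s]` / `Matrix[Aiota,s].Matrix[ANonRep,s]` of the notebook.
[cite: FitznerVanDerHofstad2017, §5.1 (5.4)–(5.5) and "Elements of the bounds" (arXiv:1506.07977v2 pp. 48–49)] -/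
theorem matB_comp_le [AddCommGroup G] [Fintype ι] [Fintype K]
    (A₁ : K → ι → ι → G → G → G → G → ℝ≥0∞) {A₂ : ι → ι → G → G → G → G → ℝ≥0∞}
    (h₂ : ∀ c b, IsTransInv (A₂ c b)) (a b : ι) :
    matB (fun κ a b => fun u v x y => ∑ c, comp (A₁ κ a c) (A₂ c b) u v x y) a b ≤ (matB A₁ * matB₀ A₂) a b := by
  rw [Matrix.mul_apply, matB_apply]
  refine iSup_le fun v => ?_
  calc ∑' x, ∑' y, ∑ κ, ∑ c, comp (A₁ κ a c) (A₂ c b) 0 v x y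
      = ∑ κ, ∑ c, ∑' x, ∑' y, comp (A₁ κ a c) (A₂ c b) 0 v x y := by simp only [tsum_finsetSum]
    _ = ∑ κ, ∑ c, ∑' w, ∑' t, A₁ κ a c 0 v w t * ∑' x, ∑' y, A₂ c b w t x y := by simp only [tsum₂_comp]
    _ ≤ ∑ κ, ∑ c, ∑' w, ∑' t, A₁ κ a c 0 v w t * normB (A₂ c b) :=
        Finset.sum_le_sum fun κ _ => Finset.sum_le_sum fun c _ =>
          ENNReal.tsum_le_tsum fun w => ENNReal.tsum_le_tsum fun t =>
            mul_le_mul' le_rfl (tsum₂_le_normB (h₂ c b) w t)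
    _ = ∑ c, (∑' w, ∑' t, ∑ κ, A₁ κ a c 0 v w t) * normB (A₂ c b) := by
        rw [Finset.sum_comm]
        simp only [ENNReal.tsum_mul_right, tsum_finsetSum, Finset.sum_mul]
    _ ≤ ∑ c, matB A₁ a c * matB₀ A₂ c b :=
        Finset.sum_le_sum fun c _ => mul_le_mul' (by
          rw [matB_apply]
          exact le_iSup (fun v => ∑' x, ∑' y, ∑ κ, A₁ κ a c 0 v x y) v) (le_of_eq (matB₀_apply A₂ c b).symm)

/-- **(5.4)/(5.5) shape at matrix level, closed ∘ double-open:** with a translation-invariant direction-free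
double-open family `A₂^{c,b}`, `matAbar (κ,a,b ↦ Σ_c A₁^{κ,a,c}∘A₂^{c,b}) ≤ matB A₁ * matAbar₀ A₂` entrywise.
[cite: FitznerVanDerHofstad2017, §5.1 "Elements of the bounds" (arXiv:1506.07977v2 p. 49)] -/
theorem matAbar_comp_le [AddCommGroup G] [Fintype ι] [Fintype K]
    (A₁ : K → ι → ι → G → G → G → G → ℝ≥0∞) {A₂ : ι → ι → G → G → G → G → ℝ≥0∞}
    (h₂ : ∀ c b, IsTransInv (A₂ c b)) (a b : ι) :
    matAbar (fun κ a b => fun u v x y => ∑ c, comp (A₁ κ a c) (A₂ c b) u v x y) a b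
      ≤ (matB A₁ * matAbar₀ A₂) a b := by
  rw [Matrix.mul_apply, matAbar_apply]
  refine iSup₂_le fun v y => ?_
  calc ∑' x, ∑ κ, ∑ c, comp (A₁ κ a c) (A₂ c b) 0 v x (x + y)
      = ∑ κ, ∑ c, ∑' x, comp (A₁ κ a c) (A₂ c b) 0 v x (x + y) := by simp only [tsum_finsetSum]
    _ = ∑ κ, ∑ c, ∑' w, ∑' t, A₁ κ a c 0 v w t * ∑' x, A₂ c b w t x (x + y) := by
        simp only [tsum_comp_diag]
    _ ≤ ∑ κ, ∑ c, ∑' w, ∑' t, A₁ κ a c 0 v w t * normOO (A₂ c b) :=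
        Finset.sum_le_sum fun κ _ => Finset.sum_le_sum fun c _ =>
          ENNReal.tsum_le_tsum fun w => ENNReal.tsum_le_tsum fun t =>
            mul_le_mul' le_rfl (tsum_le_normOO (h₂ c b) w t y)
    _ = ∑ c, (∑' w, ∑' t, ∑ κ, A₁ κ a c 0 v w t) * normOO (A₂ c b) := by
        rw [Finset.sum_comm]
        simp only [ENNReal.tsum_mul_right, tsum_finsetSum, Finset.sum_mul]
    _ ≤ ∑ c, matB A₁ a c * matAbar₀ A₂ c b :=
        Finset.sum_le_sum fun c _ => mul_le_mul' (by
          rw [matB_apply]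
          exact le_iSup (fun v => ∑' x, ∑' y, ∑ κ, A₁ κ a c 0 v x y) v) (le_of_eq (matAbar₀_apply A₂ c b).symm)

/-- Sub-additivity of `matB` (the `+` of (5.4)/(5.5) at matrix level). [folklore] -/
theorem matB_add_le [AddCommGroup G] [Fintype K] (B₁ B₂ : K → ι → ι → G → G → G → G → ℝ≥0∞) (a b : ι) :
    matB (fun κ a b => fun u v x y => B₁ κ a b u v x y + B₂ κ a b u v x y) a b ≤ (matB B₁ + matB B₂) a b := by
  rw [Matrix.add_apply, matB_apply, matB_apply, matB_apply]
  refine iSup_le fun v => ?_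
  simp only [Finset.sum_add_distrib, ENNReal.tsum_add]
  exact add_le_add (le_iSup (fun v => ∑' x, ∑' y, ∑ κ, B₁ κ a b 0 v x y) v)
    (le_iSup (fun v => ∑' x, ∑' y, ∑ κ, B₂ κ a b 0 v x y) v)

/-- Sub-additivity of `matAbar`. [folklore] -/
theorem matAbar_add_le [AddCommGroup G] [Fintype K] (A₁ A₂ : K → ι → ι → G → G → G → G → ℝ≥0∞) (a b : ι) :
    matAbar (fun κ a b => fun u v x y => A₁ κ a b u v x y + A₂ κ a b u v x y) a b
      ≤ (matAbar A₁ + matAbar A₂) a b := by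
  rw [Matrix.add_apply, matAbar_apply, matAbar_apply, matAbar_apply]
  refine iSup₂_le fun v y => ?_
  simp only [Finset.sum_add_distrib, ENNReal.tsum_add]
  exact add_le_add (le_iSup₂ (f := fun v y => ∑' x, ∑ κ, A₁ κ a b 0 v x (x + y)) v y)
    (le_iSup₂ (f := fun v y => ∑' x, ∑ κ, A₂ κ a b 0 v x (x + y)) v y)

/-- **(5.4), second term, at matrix level** (composition with a vertex kernel on the last leg; the notebook's
`Matrix[Aiota,s]*Bound[PS,0,s]`): `matB (κ,a,b ↦ Σ_t A^{κ,a,b}(·,·,·,t) q(y−t)) ≤ matB A · Σ_z q(z)` entrywise.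
[cite: FitznerVanDerHofstad2017, §5.1 (5.4) (arXiv:1506.07977v2 p. 48)] -/
theorem matB_compVertex_le [AddCommGroup G] [Fintype K] (A : K → ι → ι → G → G → G → G → ℝ≥0∞)
    (q : G → ℝ≥0∞) (a b : ι) :
    matB (fun κ a b => fun u v x y => ∑' t, A κ a b u v x t * q (y - t)) a b ≤ matB A a b * ∑' z, q z := by
  have h : (fun u v x y => ∑ κ, ∑' t, A κ a b u v x t * q (y - t))
      = fun u v x y => ∑' t, (∑ κ, A κ a b u v x t) * q (y - t) := by
    funext u v x y
    rw [← tsum_finsetSum]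
    simp only [Finset.sum_mul]
  change normB (fun u v x y => ∑ κ, ∑' t, A κ a b u v x t * q (y - t))
    ≤ normB (fun u v x y => ∑ κ, A κ a b u v x y) * ∑' z, q z
  rw [h]
  exact normB_compVertex_le _ q

end MatrixLevel

end Literature.Probability.FitznerVanDerHofstad2017.BlockSummation

end
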